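import Summits.QuantumFields.YangMills.Theorems.BalabanUVNodesN15BackgroundCovariantEntriesNode
import Summits.QuantumFields.YangMills.Theorems.BalabanUVNodesN15BackgroundCovariantEntry2
import HarnessLib

/-!
# THE TWO-SIDED BY-PARTS FAMILY WITH ALL FOUR (3.42) ENTRIES COVARIANT — `X`, `∇_{U′}X`, `X∇*_{U′}`, `Δ_{U′}X` — FILE 34 with FILE 36's covariant entry 2 in place of the flat by-parts
# `X∇*`: the kernel family and the per-index `EtaRateIneq342` from the letter bundle (dag-n15-c g10, FILE 37a; Track-A node N15 = NE2, s1 «background-layer OPERATOR ingredient»)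

`--kind definition --supports stmt-QuantumFields-20544 --as helper` (K3⁷; count-neutral).  Imports BY NAME this seat's FILE 34 `…BackgroundCovariantEntriesNode` (`covConst1`, `covConst3`, their
`_nonneg`; through it FILE 33 and FILE 24's inputs) and FILE 36 `…BackgroundCovariantEntry2` (`covEntry2`, `hasMaj_idef_covEntry2`; FILE 3 `hasMaj_entry2_of_letters`, FILE 7a `idef_comp_injJ`,
FILE 1 `hasMaj_injJ`); nothing in the tree is modified.

WHAT.  §1 defs `covConst2` (entry-2 constant), `bgOpsM₂RCC` (entries: 0; `𝔇(covEntry1′, covEntry1)`; `𝔇(covEntry2′, covEntry2)`; `𝔇(covEntry3′, covEntry3)`), `bgFamilyM₂RCC`.  §2 ★★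
`etaRateIneq342_twoSidedCovAll_of_letters` (FILE 34 §2 plus the fine by-parts entry-2 majorant of FILE 3 `hasMaj_entry2_of_letters` and FILE 36's entry-2 letter;
`B₀ = B₀^{flat} + covConst1 + covConst2 + covConst3`).  The node theorem is FILE 37b.

HONEST FRAMING.  Bookkeeping over hypothesis-shaped letters (discharged on the torus in the sequel FILE 38); the four entries are covariant w.r.t. the transports `1 + ηa⁺` ∕ the FILE 28
species — for the exact coefficients Bałaban's `∇_{U′}`, `∇*_{U′}` (transpose-adjoint: orthonormal coordinates), `Δ_{U′}` at `U′ = e^{iηA}`; `U ≡ 1` chart; `DRD*`, `aQ*Q` at `U ≡ 1`; NE2⁺ NOT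
PRINTED; count-neutral; N15 NOT discharged; one finite torus at fixed ε — NOT ℝ⁴, NOT infinite volume, NOT OS, NOT a mass gap, NOT Clay.
-/

noncomputable section

open scoped BigOperators
open Finset

namespace Summit.QuantumFields.YangMills.BalabanUVNodes.N15.BackgroundLayer

open Literature.MathematicalPhysics.QuantumFieldTheory.Balaban1983to89
open Literature.MathematicalPhysics.QuantumFieldTheory.Balaban1983to89.B11SectG (BlockNorm HasMaj RowSum hasMaj_comp hasMaj_comp_exp hasMaj_zero)
open Literature.MathematicalPhysics.QuantumFieldTheory.Balaban1983to89.T4EtaRate (PairedInstance EtaPairing EtaRateIneq342 NE2PlusOperator rateFactor)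
open Literature.MathematicalPhysics.QuantumFieldTheory.Balaban1983to89.T4EtaRateDefect (idef idef_apply idef_comp idef_zero rateWeight)
open Literature.MathematicalPhysics.QuantumFieldTheory.Balaban1983to89.T4EtaRateCoeffDefect (pull pull_apply diagK diagK_nonneg)
open Literature.MathematicalPhysics.QuantumFieldTheory.Balaban1983to89.B6RandomWalk (Triangle254)
open Summit.QuantumFields.YangMills.BalabanUVNodes.N15.OperatorReadout (opGeo opFamily opGeo_len rateFactor_opGeo etaRateIneq342_of_hasMaj_rateWeight)
open Summit.QuantumFields.YangMills.BalabanUVNodes.N15.MatrixSpecies (mmulOp liftEquiv liftMap liftBlk)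
open Summit.QuantumFields.YangMills.BalabanUVNodes.N15.SiteLayer (hasMaj_exp_comp_diagK hasMaj_diagK_comp_exp hasMaj_add_exp hasMaj_exp_mono)


variable {d : ℕ}

/-! ## §1 The all-covariant kernel family -/

section Defs

variable {X X' : Type} (J ι : Type) [Fintype ι] [Fintype X'] [DecidableEq X] [Fintype X] [Fintype J] [DecidableEq X'] [DecidableEq J] [DecidableEq ι]

/-- The constant of the covariant entry 2: `|ι|·(4a·c_r·srcConst(|J|, β, 2β, a(1+|J⊕J|), c_r) + (1+a)·bpConst2L + 2βa + a·bgConst)` (FILE 36 `hasMaj_idef_covEntry2` at the fine by-parts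
entry-2 majorant `≤ 2c_r·srcConst`, `m₂ = bpConst2L·θ`, `β_X = 2β`, `m₀ = bgConst·θ`, `o = aθ`, `o_R = 2aθ`). [folklore] -/
def covConst2 (nι nJ nJ2 β cr m₀ a cT mT : ℝ) : ℝ :=
  nι * (srcConst nJ β (β * 2) (a * (1 + nJ2)) cr * 2 * cr * (2 * a) + bpConst2L nJ nJ2 β cr m₀ a cT mT * (1 + a) + (β * 2 * a + bgConst β cr m₀ (1 + nJ2) a * a))

omit [Fintype ι] [Fintype X'] [DecidableEq X] [Fintype X] [Fintype J] [DecidableEq X'] [DecidableEq J] [DecidableEq ι] in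
/-- `0 ≤ covConst2`. [folklore] -/
theorem covConst2_nonneg {nι nJ nJ2 β cr m₀ a cT mT : ℝ} (hnι : 0 ≤ nι) (hnJ : 0 ≤ nJ) (hnJ2 : 0 ≤ nJ2) (hβ : 0 ≤ β) (hcr : 0 ≤ cr) (hm₀ : 0 ≤ m₀) (ha : 0 ≤ a) (hcT : 0 ≤ cT)
    (hmT : 0 ≤ mT) (hq : 1 * rowConst nJ β cT a cr * cr * cr < 1) : 0 ≤ covConst2 nι nJ nJ2 β cr m₀ a cT mT := by
  have h1 : 0 ≤ bgConst β cr m₀ (1 + nJ2) a := bgConst_nonneg hβ hcr hm₀ (by linarith) ha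
  have h2 : 0 ≤ bpConst2L nJ nJ2 β cr m₀ a cT mT := bpConst2L_nonneg hnJ hnJ2 hβ hcr hm₀ ha hcT hmT hq
  have h3 : 0 ≤ srcConst nJ β (β * 2) (a * (1 + nJ2)) cr := by unfold srcConst; positivity
  unfold covConst2; positivity

/-- THE FOUR ENTRY OPERATORS, ALL COVARIANT: entry 0, `𝔇(covEntry1′, covEntry1)`, `𝔇(covEntry2′, covEntry2)`, `𝔇(covEntry3′, covEntry3)` (spacings `η′ = n′⁻¹`, `η = n⁻¹`). [cite: Balaban1985BackgroundPropagators, (3.42) p.397 (the four entries, covariant ∇_U, Δ_U: shape)] -/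
def bgOpsM₂RCC {Cfg : Type} (cfgF : Cfg → (X' → Matrix ι ι ℝ) × (J ⊕ J → X' → Matrix ι ι ℝ)) (cfgC : Cfg → (X → Matrix ι ι ℝ) × (J ⊕ J → X → Matrix ι ι ℝ)) (π : X' → X)
    (τ : J → X ≃ X) (τ' : J → X' ≃ X') (n n' : ℝ) (ν : J) (G D₃ : (X × ι → ℝ) →ₗ[ℝ] (X × ι → ℝ)) (D : J ⊕ J → (X × ι → ℝ) →ₗ[ℝ] (X × ι → ℝ))
    (G' D₃' : (X' × ι → ℝ) →ₗ[ℝ] (X' × ι → ℝ)) (D' : J ⊕ J → (X' × ι → ℝ) →ₗ[ℝ] (X' × ι → ℝ)) : Fin 4 → Cfg → ((X × ι → ℝ) →ₗ[ℝ] (X' × ι → ℝ)) :=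
  fun k U => ![idef (pull (liftMap π ι)) (pull (liftMap π ι)) (projO none ∘ₗ bgPairM G' D' (cfgF U).1 (cfgF U).2) (projO none ∘ₗ bgPairM G D (cfgC U).1 (cfgC U).2),
    idef (pull (liftMap π ι)) (pull (liftMap π ι)) (covEntry1 n'⁻¹ G' D' (cfgF U).1 (cfgF U).2 ν) (covEntry1 n⁻¹ G D (cfgC U).1 (cfgC U).2 ν),
    idef (pull (liftMap π ι)) (pull (liftMap π ι)) (covEntry2 τ' n'⁻¹ n' G' D' (cfgF U).1 (cfgF U).2 ν) (covEntry2 τ n⁻¹ n G D (cfgC U).1 (cfgC U).2 ν),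
    idef (pull (liftMap π ι)) (pull (liftMap π ι)) (covEntry3 G' D₃' D' (cfgF U).1 (cfgF U).2) (covEntry3 G D₃ D (cfgC U).1 (cfgC U).2)] k

/-- THE KERNEL FAMILY WITH ALL ENTRIES COVARIANT on the realised two-sided instance (n15-b `opFamily` of `bgOpsM₂RCC`). [cite: Balaban1985BackgroundPropagators, (3.42) p.397 (shape)] -/
def bgFamilyM₂RCC {g : B6.Geometry} (blk : X → g.Site) (π : X' → X) (m : ℕ) (Bc Bf : B9.Backgrounds)
    (P : EtaPairing (opGeo g (X × ι) (liftBlk blk ι)) (fineGeo g (X' × ι) (liftBlk (blk ∘ π) ι) m) Bc Bf) (cfgF : Bf.Cfg → (X' → Matrix ι ι ℝ) × (J ⊕ J → X' → Matrix ι ι ℝ))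
    (cfgC : Bf.Cfg → (X → Matrix ι ι ℝ) × (J ⊕ J → X → Matrix ι ι ℝ)) (τ : J → X ≃ X) (τ' : J → X' ≃ X') (n n' : ℝ) (ν : J) (G D₃ : (X × ι → ℝ) →ₗ[ℝ] (X × ι → ℝ))
    (D : J ⊕ J → (X × ι → ℝ) →ₗ[ℝ] (X × ι → ℝ)) (G' D₃' : (X' × ι → ℝ) →ₗ[ℝ] (X' × ι → ℝ)) (D' : J ⊕ J → (X' × ι → ℝ) →ₗ[ℝ] (X' × ι → ℝ)) :
    B9.KernelFamily (bgInstanceM₂R (ι := ι) blk π m Bc Bf P).gc (bgInstanceM₂R (ι := ι) blk π m Bc Bf P).Bf :=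
  show B9.KernelFamily (opGeo g (X × ι) (liftBlk blk ι)) Bf from
    opFamily (g := g) (B := Bf) (liftBlk blk ι) (liftBlk (blk ∘ π) ι) (bgOpsM₂RCC J ι cfgF cfgC π τ τ' n n' ν G D₃ D G' D₃' D')

end Defs

/-! ## §2 Per index `EtaRateIneq342` for the all-covariant family -/

section PerIndex

variable {X X' J ι : Type} [Fintype X] [Fintype X'] [Fintype J] [Fintype ι] [DecidableEq X] [DecidableEq X'] [DecidableEq J] [DecidableEq ι]
  {g : B6.Geometry} (blk : X → g.Site) (π : X' → X) {B : B9.Backgrounds}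
variable {τ : J → X ≃ X} {τ' : J → X' ≃ X'} {n n' : ℝ} {G D₃ : (X × ι → ℝ) →ₗ[ℝ] (X × ι → ℝ)} {D : J ⊕ J → (X × ι → ℝ) →ₗ[ℝ] (X × ι → ℝ)}
  {G' D₃' : (X' × ι → ℝ) →ₗ[ℝ] (X' × ι → ℝ)} {D' : J ⊕ J → (X' × ι → ℝ) →ₗ[ℝ] (X' × ι → ℝ)}

/-- **`EtaRateIneq342` PER INDEX FROM THE LETTER BUNDLE** (`B₀ = bgConst(…) + bgConst1(…)` at `K = 1 + |J ⊕ J|`, `a₀ = a` `+ bpConst2L(…)`, `δ₀ = δ − 6σ`): a carrier `B` with readings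
`cfgF, cfgC`, a configuration `U` whose read configurations obey `TwoSidedLetters … a θ`, the guards `β((1+|J ⊕ J|)a)c_r ≤ ½`, `rowConst(|J|, β, c_T, a, c_r)c_r² ≤ ½`, the `U ≡ 1` layer
(pieces, derived pieces over `J ⊕ J`, Laplacian pieces, entry-2 operators, their defects, shifts) and the shift-defect row letter at the coarse forward coefficients; `η, L > 0`, sites of size
`≥ 1`, `θ ≤ (L^j)^{−γ}`.  Entries 0∕1∕3 by g2 V0 `hasMaj_entries_of_letters` (three perturbation letters: M1 `hasMaj_unstackM` ∕ `hasMaj_idef_unstackM`), entry 2 by FILE 23.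
[cite: Balaban1985BackgroundPropagators, Thm 3.1 (3.42) p.397 (shape, quantifier template)] -/
theorem etaRateIneq342_twoSidedCovAll_of_letters (htri : Triangle254 g) (hd : ∀ a b : g.Site, 0 ≤ g.dist a b) (hd0 : ∀ y : g.Site, g.dist y y = 0) {σ cr : ℝ} (hσ : 0 ≤ σ)
    (hcr : 0 ≤ cr) (hrow : RowSum g σ cr) (hη : 0 < g.eta) (hL : 0 < g.L) (hlen : ∀ y, 1 ≤ g.len y) {δ β m₀ θ a γ cT mT : ℝ} (hσδ : 6 * σ ≤ δ)
    (hβ : 0 ≤ β) (hm₀ : 0 ≤ m₀) (hθ : 0 ≤ θ) (hθγ : ∀ y, θ ≤ rateWeight g γ y) (ha : 0 ≤ a) (hq : β * ((1 + Fintype.card (J ⊕ J)) * a) * cr ≤ 1 / 2) (hcT : 0 ≤ cT)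
    (hmT : 0 ≤ mT) (hq2 : 1 * rowConst (Fintype.card J) β cT a cr * cr * cr ≤ 1 / 2)
    (hn'0 : 0 ≤ n'⁻¹) (hn'n : n'⁻¹ ≤ n⁻¹) (hnθ : n⁻¹ ≤ θ) (hθ1 : θ ≤ 1) {ν : J}
    (hG : HasMaj (BlockNorm.ofBlocks g (liftBlk blk ι)) (BlockNorm.ofBlocks g (liftBlk blk ι)) G (fun y y' => β * Real.exp (-(δ * g.dist y y'))))
    (hD : ∀ μ, HasMaj (BlockNorm.ofBlocks g (liftBlk blk ι)) (BlockNorm.ofBlocks g (liftBlk blk ι)) (D μ) (fun y y' => β * Real.exp (-(δ * g.dist y y'))))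
    (hG' : HasMaj (BlockNorm.ofBlocks g (liftBlk (blk ∘ π) ι)) (BlockNorm.ofBlocks g (liftBlk (blk ∘ π) ι)) G' (fun y y' => β * Real.exp (-(δ * g.dist y y'))))
    (hD' : ∀ μ, HasMaj (BlockNorm.ofBlocks g (liftBlk (blk ∘ π) ι)) (BlockNorm.ofBlocks g (liftBlk (blk ∘ π) ι)) (D' μ) (fun y y' => β * Real.exp (-(δ * g.dist y y'))))
    (hD₃' : HasMaj (BlockNorm.ofBlocks g (liftBlk (blk ∘ π) ι)) (BlockNorm.ofBlocks g (liftBlk (blk ∘ π) ι)) D₃' (fun y y' => β * Real.exp (-(δ * g.dist y y'))))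
    (hDG : HasMaj (BlockNorm.ofBlocks g (liftBlk blk ι)) (BlockNorm.ofBlocks g (liftBlk (blk ∘ π) ι)) (idef (pull (liftMap π ι)) (pull (liftMap π ι)) G' G)
      (fun y y' => m₀ * θ * Real.exp (-(δ * g.dist y y'))))
    (hDD : ∀ μ, HasMaj (BlockNorm.ofBlocks g (liftBlk blk ι)) (BlockNorm.ofBlocks g (liftBlk (blk ∘ π) ι)) (idef (pull (liftMap π ι)) (pull (liftMap π ι)) (D' μ) (D μ))
      (fun y y' => m₀ * θ * Real.exp (-(δ * g.dist y y'))))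
    (hDD₃ : HasMaj (BlockNorm.ofBlocks g (liftBlk blk ι)) (BlockNorm.ofBlocks g (liftBlk (blk ∘ π) ι)) (idef (pull (liftMap π ι)) (pull (liftMap π ι)) D₃' D₃)
      (fun y y' => m₀ * θ * Real.exp (-(δ * g.dist y y'))))
    (hS : ∀ ν, HasMaj (BlockNorm.ofBlocks g (liftBlk blk ι)) (BlockNorm.ofBlocks g (liftBlk blk ι)) (G ∘ₗ fgradAdj n (liftEquiv (τ ν) ι)) (fun y y' => β * Real.exp (-(δ * g.dist y y'))))
    (hS' : ∀ ν, HasMaj (BlockNorm.ofBlocks g (liftBlk (blk ∘ π) ι)) (BlockNorm.ofBlocks g (liftBlk (blk ∘ π) ι)) (G' ∘ₗ fgradAdj n' (liftEquiv (τ' ν) ι)) (fun y y' => β * Real.exp (-(δ * g.dist y y'))))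
    (hDS : ∀ ν, HasMaj (BlockNorm.ofBlocks g (liftBlk blk ι)) (BlockNorm.ofBlocks g (liftBlk (blk ∘ π) ι))
      (idef (pull (liftMap π ι)) (pull (liftMap π ι)) (G' ∘ₗ fgradAdj n' (liftEquiv (τ' ν) ι)) (G ∘ₗ fgradAdj n (liftEquiv (τ ν) ι))) (fun y y' => m₀ * θ * Real.exp (-(δ * g.dist y y'))))
    (hSh : ∀ μ, HasMaj (BlockNorm.ofBlocks g (liftBlk blk ι)) (BlockNorm.ofBlocks g (liftBlk blk ι)) (pull (liftEquiv (τ μ) ι)) (fun y y' => cT * Real.exp (-(δ * g.dist y y'))))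
    (hSh' : ∀ μ, HasMaj (BlockNorm.ofBlocks g (liftBlk (blk ∘ π) ι)) (BlockNorm.ofBlocks g (liftBlk (blk ∘ π) ι)) (pull (liftEquiv (τ' μ) ι)) (fun y y' => cT * Real.exp (-(δ * g.dist y y'))))
    {cfgF : B.Cfg → (X' → Matrix ι ι ℝ) × (J ⊕ J → X' → Matrix ι ι ℝ)} {cfgC : B.Cfg → (X → Matrix ι ι ℝ) × (J ⊕ J → X → Matrix ι ι ℝ)} {U : B.Cfg}
    (hLt : TwoSidedLetters J ι π τ τ' n n' a θ (cfgF U) (cfgC U))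
    (hDSh : ∀ μ, HasMaj (BlockNorm.ofBlocks g (liftBlk (liftBlk blk ι) J)) (BlockNorm.ofBlocks g (liftBlk (blk ∘ π) ι))
      (idef (pull (liftMap π ι)) (pull (liftMap π ι)) (pull (liftEquiv (τ' μ) ι)) (pull (liftEquiv (τ μ) ι)) ∘ₗ
        (mmulOp ((cfgC U).2 (Sum.inl μ) ∘ ⇑(τ μ).symm) ∘ₗ sumJ fun ν => G ∘ₗ fgradAdj n (liftEquiv (τ ν) ι))) (fun y y' => mT * θ * Real.exp (-(δ * g.dist y y')))) :
    EtaRateIneq342 (opFamily (g := g) (B := B) (liftBlk blk ι) (liftBlk (blk ∘ π) ι) (bgOpsM₂RCC J ι cfgF cfgC π τ τ' n n' ν G D₃ D G' D₃' D'))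
      (bgConst β cr m₀ (1 + Fintype.card (J ⊕ J)) a + bgConst1 β cr m₀ (1 + Fintype.card (J ⊕ J)) a + bpConst2L (Fintype.card J) (Fintype.card (J ⊕ J)) β cr m₀ a cT mT +
        covConst1 β cr m₀ (1 + Fintype.card (J ⊕ J)) a + covConst2 (Fintype.card ι) (Fintype.card J) (Fintype.card (J ⊕ J)) β cr m₀ a cT mT +
        covConst3 (Fintype.card J) β cr m₀ (1 + Fintype.card (J ⊕ J)) a)
      (δ - 6 * σ) γ U := by
  obtain ⟨hc, hA, hc', hA', hfc, hfA, hga, hga', hgb, hgb', hfaT, hfgT, -, hfbT, hfgb⟩ := hLt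
  have hnJ : (0 : ℝ) ≤ Fintype.card J := Nat.cast_nonneg _
  have hnJ2 : (0 : ℝ) ≤ Fintype.card (J ⊕ J) := Nat.cast_nonneg _
  have hJ0 : (0 : ℝ) ≤ 1 + Fintype.card (J ⊕ J) := by positivity
  have haθ : 0 ≤ a * θ := mul_nonneg ha hθ
  have hσδ' : σ ≤ δ := by linarith
  have hR0 : 0 ≤ a * (1 + Fintype.card (J ⊕ J)) := mul_nonneg ha hJ0
  -- V0: entries 0∕1∕3 from the three perturbation letters (mixed slots fed with zeros)
  have hz : ∀ {F₁ F₂ : Type} [AddCommGroup F₁] [Module ℝ F₁] [AddCommGroup F₂] [Module ℝ F₂] (b₁ : BlockNorm g F₁) (b₂ : BlockNorm g F₂) (c : ℝ), 0 ≤ c →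
      HasMaj b₁ b₂ (0 : F₁ →ₗ[ℝ] F₂) (fun y y' => c * Real.exp (-(δ * g.dist y y'))) := fun b₁ b₂ c hc0 =>
    (hasMaj_zero b₁ b₂).mono fun _ _ => mul_nonneg hc0 (Real.exp_nonneg _)
  have hV : HasMaj (BlockNorm.ofBlocks g (blkPair (liftBlk blk ι))) (BlockNorm.ofBlocks g (liftBlk blk ι)) (unstackM (cfgC U).1 (cfgC U).2)
      (diagK fun _ => a * (1 + Fintype.card (J ⊕ J))) := hasMaj_unstackM blk ha hc hA
  have hV' : HasMaj (BlockNorm.ofBlocks g (blkPair (liftBlk (blk ∘ π) ι))) (BlockNorm.ofBlocks g (liftBlk (blk ∘ π) ι)) (unstackM (cfgF U).1 (cfgF U).2)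
      (diagK fun _ => a * (1 + Fintype.card (J ⊕ J))) := hasMaj_unstackM (blk ∘ π) ha hc' hA'
  have hDV : HasMaj (BlockNorm.ofBlocks g (blkPair (liftBlk blk ι))) (BlockNorm.ofBlocks g (liftBlk (blk ∘ π) ι))
      (idef (pull (liftPair (liftMap π ι))) (pull (liftMap π ι)) (unstackM (cfgF U).1 (cfgF U).2) (unstackM (cfgC U).1 (cfgC U).2))
      (diagK fun _ => a * (1 + Fintype.card (J ⊕ J)) * θ) :=
    (hasMaj_idef_unstackM blk π haθ hfc hfA).mono fun y y' =>
      T4EtaRateCoeffDefect.diagK_mono (fun _ => (by ring : a * θ * (1 + (Fintype.card (J ⊕ J) : ℝ)) = a * (1 + Fintype.card (J ⊕ J)) * θ).le) y y'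
  have h013 := hasMaj_entries_of_letters (liftBlk blk ι) (liftMap π ι) htri hd hσ hcr hrow hσδ' hβ hm₀ hθ hJ0 ha hq hR0
    (le_of_eq (by ring)) hG hD hG' hD' (hz _ _ β hβ) (S := 0) (SD := fun _ => 0) (S' := 0) (SD' := fun _ => 0) (fun _ => hz _ _ β hβ) hD₃'
    hDG hDD (by rw [idef_zero]; exact hz _ _ (m₀ * θ) (mul_nonneg hm₀ hθ)) (fun _ => by rw [idef_zero]; exact hz _ _ (m₀ * θ) (mul_nonneg hm₀ hθ)) hDD₃ hV hV' hDV
  have h01 := h013.1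
  have h3 := h013.2.2
  have h2 := hasMaj_entry2_byParts_matrix₂_of_letters blk π htri hd hd0 hσ hcr hrow hσδ hβ hm₀ hθ ha hq hcT hmT hq2 hG hD hG' hD' hDG hDD hS hS' hDS hSh hSh'
    hc hA hc' hA' hfc hfA hga hga' hgb hgb' hfaT hfgT hfbT hfgb hDSh ν
  -- the coarse component majorants `≤ 2β·e^{−(δ−σ)d}` (n15-b `hasMaj_bgPropV` at `ρ = δ − σ`, `(1 − q)⁻¹ ≤ 2`)
  have hq1 : β * (a * (1 + Fintype.card (J ⊕ J))) * cr < 1 := by nlinarith [hq]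
  have hinv2 : (1 - β * (a * (1 + Fintype.card (J ⊕ J))) * cr)⁻¹ ≤ 2 := by
    have hq' : β * (a * (1 + Fintype.card (J ⊕ J))) * cr ≤ 1 / 2 := by nlinarith [hq]
    rw [inv_le_comm₀ (by linarith) (by norm_num : (0:ℝ) < 2)]; linarith
  have hKβ : ∀ y y' : g.Site, 0 ≤ β * Real.exp (-(δ * g.dist y y')) := fun _ _ => mul_nonneg hβ (Real.exp_nonneg _)
  have hXhat := hasMaj_bgPropV (liftBlk blk ι) (blkPair (liftBlk blk ι)) htri hd hrow hσ (ρ := δ - σ) (by linarith) (by linarith) hβ hR0 (hasMaj_stack _ hKβ hG hD) hV hq1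
  have hXj : ∀ j : Option (J ⊕ J), HasMaj (BlockNorm.ofBlocks g (liftBlk blk ι)) (BlockNorm.ofBlocks g (liftBlk blk ι)) (projO j ∘ₗ bgPairM G D (cfgC U).1 (cfgC U).2)
      (fun y y' => 2 * β * Real.exp (-((δ - σ) * g.dist y y'))) := fun j =>
    (hasMaj_projO_comp (liftBlk blk ι) hXhat j).mono fun y y' => by
      have hE := Real.exp_nonneg (-((δ - σ) * g.dist y y'))
      calc β * (1 - β * (a * (1 + ↑(Fintype.card (J ⊕ J)))) * cr)⁻¹ * Real.exp (-((δ - σ) * g.dist y y'))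
          ≤ β * 2 * Real.exp (-((δ - σ) * g.dist y y')) := mul_le_mul_of_nonneg_right (mul_le_mul_of_nonneg_left hinv2 hβ) hE
        _ = 2 * β * Real.exp (-((δ - σ) * g.dist y y')) := by ring
  -- the transport fit `Σ|(1 + η′A′⁺) − (1 + ηA⁺∘π)| ≤ 2aθ`
  have hfR : ∀ x' i, ∑ j, |(1 + n'⁻¹ • (cfgF U).2 (Sum.inl ν) x') i j - (1 + n⁻¹ • (cfgC U).2 (Sum.inl ν) (π x')) i j| ≤ 2 * a * θ := by
    intro x' i
    have h1 := hfA (Sum.inl ν) x' i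
    have h2 := hA (Sum.inl ν) (π x') i
    calc ∑ j, |(1 + n'⁻¹ • (cfgF U).2 (Sum.inl ν) x') i j - (1 + n⁻¹ • (cfgC U).2 (Sum.inl ν) (π x')) i j|
        ≤ ∑ j, (n'⁻¹ * |(cfgF U).2 (Sum.inl ν) x' i j - (cfgC U).2 (Sum.inl ν) (π x') i j| + (n⁻¹ - n'⁻¹) * |(cfgC U).2 (Sum.inl ν) (π x') i j|) :=
          Finset.sum_le_sum fun j _ => by
            rw [show (1 + n'⁻¹ • (cfgF U).2 (Sum.inl ν) x') i j - (1 + n⁻¹ • (cfgC U).2 (Sum.inl ν) (π x')) i j =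
                n'⁻¹ * ((cfgF U).2 (Sum.inl ν) x' i j - (cfgC U).2 (Sum.inl ν) (π x') i j) - (n⁻¹ - n'⁻¹) * (cfgC U).2 (Sum.inl ν) (π x') i j by
              simp only [Matrix.add_apply, Matrix.smul_apply, smul_eq_mul]; ring]
            refine (abs_sub _ _).trans (le_of_eq ?_)
            rw [abs_mul, abs_mul, abs_of_nonneg hn'0, abs_of_nonneg (sub_nonneg.mpr hn'n)]
      _ = n'⁻¹ * ∑ j, |(cfgF U).2 (Sum.inl ν) x' i j - (cfgC U).2 (Sum.inl ν) (π x') i j| + (n⁻¹ - n'⁻¹) * ∑ j, |(cfgC U).2 (Sum.inl ν) (π x') i j| := by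
          rw [Finset.sum_add_distrib, Finset.mul_sum, Finset.mul_sum]
      _ ≤ 1 * (a * θ) + θ * a := add_le_add (mul_le_mul (hn'n.trans (hnθ.trans hθ1)) h1 (Finset.sum_nonneg fun _ _ => abs_nonneg _) zero_le_one)
          (mul_le_mul (by linarith) h2 (Finset.sum_nonneg fun _ _ => abs_nonneg _) hθ)
      _ = 2 * a * θ := by ring
  have hcov1 := hasMaj_idef_covEntry1 blk π (η' := n'⁻¹) (η := n⁻¹) hn'0 (hn'n.trans (hnθ.trans hθ1)) ha haθ (by positivity : 0 ≤ 2 * a * θ) ν (hA' (Sum.inl ν)) (hfA (Sum.inl ν)) hfR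
    (h01 none) (h01 (some (Sum.inl ν))) (hXj none) (hXj (some (Sum.inl ν)))
  have hcov3 := hasMaj_idef_covEntry3 blk π (D₃ := D₃) (D₃' := D₃') ha haθ hc' hA' hfc hfA h01 hXj h3
  have hCC1 : 0 ≤ covConst1 β cr m₀ (1 + Fintype.card (J ⊕ J)) a := covConst1_nonneg hβ hcr hm₀ hJ0 ha
  have hCC3 : 0 ≤ covConst3 (Fintype.card J) β cr m₀ (1 + Fintype.card (J ⊕ J)) a := covConst3_nonneg hnJ hβ hcr hm₀ hJ0 ha
  have hC0 : 0 ≤ bgConst β cr m₀ (1 + Fintype.card (J ⊕ J)) a := bgConst_nonneg hβ hcr hm₀ hJ0 ha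
  have hC1 : 0 ≤ bgConst1 β cr m₀ (1 + Fintype.card (J ⊕ J)) a := bgConst1_nonneg hβ hcr hm₀ hJ0 ha
  have hC2 : 0 ≤ bpConst2L (Fintype.card J) (Fintype.card (J ⊕ J)) β cr m₀ a cT mT := bpConst2L_nonneg hnJ hnJ2 hβ hcr hm₀ ha hcT hmT (by linarith)
  -- the fine by-parts entry-2 majorant (FILE 3 `hasMaj_entry2_of_letters` on the fine lattice; letters as in FILE 23's proof) and FILE 36's entry-2 letter
  have hV' : HasMaj (BlockNorm.ofBlocks g (blkPair (liftBlk (blk ∘ π) ι))) (BlockNorm.ofBlocks g (liftBlk (blk ∘ π) ι)) (unstackM (cfgF U).1 (cfgF U).2)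
      (diagK fun _ => a * (1 + Fintype.card (J ⊕ J))) := hasMaj_unstackM (blk ∘ π) ha hc' hA'
  have hSG' := hasMaj_stack (liftBlk (blk ∘ π) ι) hKβ hG' hD'
  have hX' := hasMaj_bgPropV (liftBlk (blk ∘ π) ι) (blkPair (liftBlk (blk ∘ π) ι)) htri hd hrow hσ (ρ := δ - σ) (by linarith) (by linarith) hβ hR0 hSG' hV' hq1
  have hE' : HasMaj (BlockNorm.ofBlocks g (liftBlk (blk ∘ π) ι)) (BlockNorm.ofBlocks g (liftBlk (blk ∘ π) ι)) (projO none ∘ₗ bgPairM G' D' (cfgF U).1 (cfgF U).2)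
      (fun y y' => β * 2 * Real.exp (-((δ - σ) * g.dist y y'))) :=
    (hasMaj_projO_comp (liftBlk (blk ∘ π) ι) hX' none).mono fun y y' =>
      mul_le_mul_of_nonneg_right (mul_le_mul_of_nonneg_left hinv2 hβ) (Real.exp_nonneg _)
  have hdiag : ∀ {t t' : ℝ}, t ≤ t' → ∀ y y' : g.Site, diagK (fun _ => t) y y' ≤ diagK (fun _ => t') y y' :=
    fun h y y' => T4EtaRateCoeffDefect.diagK_mono (fun _ => h) y y'
  have hJ2 : (Fintype.card (J ⊕ J) : ℝ) = Fintype.card J + Fintype.card J := by rw [Fintype.card_sum]; push_cast; ring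
  have hrR : a + Fintype.card J * (a + a) ≤ a * (1 + Fintype.card (J ⊕ J)) := by rw [hJ2]; nlinarith
  have hR' : HasMaj (BlockNorm.ofBlocks g (liftBlk (blk ∘ π) ι)) (BlockNorm.ofBlocks g (liftBlk (blk ∘ π) ι))
      (mmulOp ((cfgF U).1 - ∑ μ, (fgradMat n' (τ' μ) ((cfgF U).2 (Sum.inl μ)) ∘ ⇑(τ' μ).symm + fgradMat n' (τ' μ) ((cfgF U).2 (Sum.inr μ)))))
      (diagK fun _ => a * (1 + Fintype.card (J ⊕ J))) :=
    (hasMaj_byPartsMult_matrix₂ (blk ∘ π) (A := fun μ => (cfgF U).2 (Sum.inl μ)) (B := fun μ => (cfgF U).2 (Sum.inr μ)) ha ha hc' hga' hgb').mono (hdiag hrR)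
  have hCa' : ∀ μ, HasMaj (BlockNorm.ofBlocks g (liftBlk (blk ∘ π) ι)) (BlockNorm.ofBlocks g (liftBlk (blk ∘ π) ι)) (mmulOp ((cfgF U).2 (Sum.inl μ) ∘ ⇑(τ' μ).symm))
      (diagK fun _ => a) := fun μ => hasMaj_mmulOp_translate (blk ∘ π) (A := fun μ => (cfgF U).2 (Sum.inl μ)) ha (fun μ => hA' (Sum.inl μ)) μ
  have hCb' : ∀ μ, HasMaj (BlockNorm.ofBlocks g (liftBlk (blk ∘ π) ι)) (BlockNorm.ofBlocks g (liftBlk (blk ∘ π) ι)) (mmulOp ((cfgF U).2 (Sum.inr μ) ∘ ⇑(τ' μ)))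
      (diagK fun _ => a) := fun μ => hasMaj_mmulOp_translate_fwd (blk ∘ π) (B := fun μ => (cfgF U).2 (Sum.inr μ)) ha (fun μ => hA' (Sum.inr μ)) μ
  have hS1' : ∀ ν, HasMaj (BlockNorm.ofBlocks g (liftBlk (blk ∘ π) ι)) (BlockNorm.ofBlocks g (liftBlk (blk ∘ π) ι)) (G' ∘ₗ fgradAdj n' (liftEquiv (τ' ν) ι))
      (fun y y' => β * Real.exp (-((δ - σ) * g.dist y y'))) := fun ν => hasMaj_exp_mono hd hβ (by linarith) (hS' ν)
  have hSh1' : ∀ μ, HasMaj (BlockNorm.ofBlocks g (liftBlk (blk ∘ π) ι)) (BlockNorm.ofBlocks g (liftBlk (blk ∘ π) ι)) (pull (liftEquiv (τ' μ) ι))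
      (fun y y' => cT * Real.exp (-((δ - σ) * g.dist y y'))) := fun μ => hasMaj_exp_mono hd hcT (by linarith) (hSh' μ)
  have hq2' : 1 * rowConst (Fintype.card J) β cT a cr * cr * cr < 1 := by linarith
  have hβ2 : 0 ≤ β * 2 := by positivity
  have hE2raw := hasMaj_entry2_of_letters (liftBlk (blk ∘ π) ι) htri hd hd0 hrow hσ hcr (ρ := δ - 6 * σ) (by linarith) (by linarith) hβ hβ2 hR0 hcT ha hS1' hE' hR' hSh1' hCa' hCb' hq2'
  have hsrc0 : 0 ≤ srcConst (Fintype.card J) β (β * 2) (a * (1 + Fintype.card (J ⊕ J))) cr := by unfold srcConst; positivity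
  have hAi : 1 * (1 - 1 * rowConst (Fintype.card J) β cT a cr * cr * cr)⁻¹ ≤ 2 := by
    rw [one_mul, inv_le_comm₀ (by linarith) (by norm_num : (0:ℝ) < 2)]; linarith
  have hAi0 : 0 ≤ 1 * (1 - 1 * rowConst (Fintype.card J) β cT a cr * cr * cr)⁻¹ := by rw [one_mul]; exact inv_nonneg.2 (by linarith)
  have hE2' : HasMaj (BlockNorm.ofBlocks g (liftBlk (blk ∘ π) ι)) (BlockNorm.ofBlocks g (liftBlk (blk ∘ π) ι)) (e2OpMBP₂ τ' n' G' D' (cfgF U).1 (cfgF U).2 ∘ₗ injJ ν)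
      (fun y y' => srcConst (Fintype.card J) β (β * 2) (a * (1 + Fintype.card (J ⊕ J))) cr * 2 * cr * Real.exp (-((δ - 6 * σ) * g.dist y y'))) := by
    have h := hasMaj_exp_comp_diagK (b₁ := BlockNorm.ofBlocks g (liftBlk (blk ∘ π) ι)) (b₃ := BlockNorm.ofBlocks g (liftBlk (blk ∘ π) ι)) (liftBlk (liftBlk (blk ∘ π) ι) J)
      (by positivity) hE2raw (hasMaj_injJ (liftBlk (blk ∘ π) ι) ν)
    refine h.mono fun y y' => ?_
    have hE := Real.exp_nonneg (-((δ - 6 * σ) * g.dist y y'))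
    calc srcConst (Fintype.card J) β (β * 2) (a * (1 + ↑(Fintype.card (J ⊕ J)))) cr * (1 * (1 - 1 * rowConst (↑(Fintype.card J)) β cT a cr * cr * cr)⁻¹) * cr * 1 *
          Real.exp (-((δ - 6 * σ) * g.dist y y'))
        = (srcConst (Fintype.card J) β (β * 2) (a * (1 + ↑(Fintype.card (J ⊕ J)))) cr * cr * Real.exp (-((δ - 6 * σ) * g.dist y y'))) *
            (1 * (1 - 1 * rowConst (↑(Fintype.card J)) β cT a cr * cr * cr)⁻¹) := by ring
      _ ≤ (srcConst (Fintype.card J) β (β * 2) (a * (1 + ↑(Fintype.card (J ⊕ J)))) cr * cr * Real.exp (-((δ - 6 * σ) * g.dist y y'))) * 2 :=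
          mul_le_mul_of_nonneg_left hAi (by positivity)
      _ = srcConst (Fintype.card J) β (β * 2) (a * (1 + ↑(Fintype.card (J ⊕ J)))) cr * 2 * cr * Real.exp (-((δ - 6 * σ) * g.dist y y')) := by ring
  have hD2 : HasMaj (BlockNorm.ofBlocks g (liftBlk blk ι)) (BlockNorm.ofBlocks g (liftBlk (blk ∘ π) ι))
      (idef (pull (liftMap π ι)) (pull (liftMap π ι)) (e2OpMBP₂ τ' n' G' D' (cfgF U).1 (cfgF U).2 ∘ₗ injJ ν) (e2OpMBP₂ τ n G D (cfgC U).1 (cfgC U).2 ∘ₗ injJ ν))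
      (fun y y' => bpConst2L (Fintype.card J) (Fintype.card (J ⊕ J)) β cr m₀ a cT mT * θ * Real.exp (-((δ - 6 * σ) * g.dist y y'))) := by
    rw [← idef_comp_injJ]; exact h2
  have hX0' : HasMaj (BlockNorm.ofBlocks g (liftBlk (blk ∘ π) ι)) (BlockNorm.ofBlocks g (liftBlk (blk ∘ π) ι)) (projO none ∘ₗ bgPairM G' D' (cfgF U).1 (cfgF U).2)
      (fun y y' => β * 2 * Real.exp (-((δ - 6 * σ) * g.dist y y'))) := hasMaj_exp_mono hd hβ2 (by linarith) hE'
  have hD0' : HasMaj (BlockNorm.ofBlocks g (liftBlk blk ι)) (BlockNorm.ofBlocks g (liftBlk (blk ∘ π) ι))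
      (idef (pull (liftMap π ι)) (pull (liftMap π ι)) (projO none ∘ₗ bgPairM G' D' (cfgF U).1 (cfgF U).2) (projO none ∘ₗ bgPairM G D (cfgC U).1 (cfgC U).2))
      (fun y y' => bgConst β cr m₀ (1 + Fintype.card (J ⊕ J)) a * θ * Real.exp (-((δ - 6 * σ) * g.dist y y'))) :=
    hasMaj_exp_mono hd (mul_nonneg hC0 hθ) (by linarith) (h01 none)
  have hcov2 := hasMaj_idef_covEntry2 blk π (τ := τ) (τ' := τ') (n := n) (n' := n') (η := n⁻¹) (η' := n'⁻¹) (hn'0.trans hn'n) (hnθ.trans hθ1) ha haθ (by positivity : 0 ≤ 2 * a * θ)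
    (mul_nonneg hC0 hθ) (mul_nonneg hC2 hθ) hβ2 (by positivity) ν (hA (Sum.inl ν)) (hfA (Sum.inl ν)) hfR hE2' hD2 hX0' hD0'
  have hCC2 : 0 ≤ covConst2 (Fintype.card ι) (Fintype.card J) (Fintype.card (J ⊕ J)) β cr m₀ a cT mT :=
    covConst2_nonneg (Nat.cast_nonneg _) hnJ hnJ2 hβ hcr hm₀ ha hcT hmT hq2'
  set B₀ := bgConst β cr m₀ (1 + Fintype.card (J ⊕ J)) a + bgConst1 β cr m₀ (1 + Fintype.card (J ⊕ J)) a + bpConst2L (Fintype.card J) (Fintype.card (J ⊕ J)) β cr m₀ a cT mT +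
        covConst1 β cr m₀ (1 + Fintype.card (J ⊕ J)) a + covConst2 (Fintype.card ι) (Fintype.card J) (Fintype.card (J ⊕ J)) β cr m₀ a cT mT +
        covConst3 (Fintype.card J) β cr m₀ (1 + Fintype.card (J ⊕ J)) a
    with hB₀def
  have hB₀ : 0 ≤ B₀ := add_nonneg (add_nonneg (add_nonneg (add_nonneg (add_nonneg hC0 hC1) hC2) hCC1) hCC2) hCC3
  -- the readout in the (3.42) shape
  refine etaRateIneq342_of_hasMaj_rateWeight (g := g) (B := B) (liftBlk blk ι) (liftBlk (blk ∘ π) ι) hη hL hB₀ (c := fun _ => B₀) (fun _ => hB₀)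
    (fun k y => le_mul_of_one_le_right hB₀ (one_le_pref4 (hlen y) k)) (bgOpsM₂RCC J ι cfgF cfgC π τ τ' n n' ν G D₃ D G' D₃' D') U fun k => ?_
  have hmono : ∀ {B ρ : ℝ}, 0 ≤ B → B ≤ B₀ → δ - 6 * σ ≤ ρ → ∀ y y' : g.Site,
      B * θ * Real.exp (-(ρ * g.dist y y')) ≤ B₀ * Real.exp (-((δ - 6 * σ) * g.dist y y')) * rateWeight g γ y' := by
    intro B ρ hB0 hB hρ y y'
    have hexp : Real.exp (-(ρ * g.dist y y')) ≤ Real.exp (-((δ - 6 * σ) * g.dist y y')) :=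
      Real.exp_le_exp.mpr (neg_le_neg (mul_le_mul_of_nonneg_right hρ (hd y y')))
    calc B * θ * Real.exp (-(ρ * g.dist y y')) ≤ B₀ * rateWeight g γ y' * Real.exp (-((δ - 6 * σ) * g.dist y y')) :=
          mul_le_mul (mul_le_mul hB (hθγ y') hθ hB₀) hexp (Real.exp_nonneg _) (mul_nonneg hB₀ (hθ.trans (hθγ y')))
      _ = B₀ * Real.exp (-((δ - 6 * σ) * g.dist y y')) * rateWeight g γ y' := by ring
  fin_cases k
  · exact (h01 none).mono (hmono hC0 (by rw [hB₀def]; linarith) (by linarith))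
  · refine (hcov1.mono fun y y' => le_of_eq ?_).mono (hmono (ρ := δ - σ) hCC1 (by rw [hB₀def]; linarith) (by linarith))
    simp only [covConst1]; ring
  · refine (hcov2.mono fun y y' => le_of_eq ?_).mono (hmono (ρ := δ - 6 * σ) hCC2 (by rw [hB₀def]; linarith) le_rfl)
    simp only [covConst2]; ring
  · refine (hcov3.mono fun y y' => le_of_eq ?_).mono (hmono (ρ := δ - σ) hCC3 (by rw [hB₀def]; linarith) (by linarith))
    simp only [covConst3]; ring

end PerIndex

end Summit.QuantumFields.YangMills.BalabanUVNodes.N15.BackgroundLayer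

end
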